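import Mathlib.Topology.Homotopy.Contractible
import Mathlib.Topology.Homotopy.Equiv
import Literature.Topology.FourManifolds.HurwitzDeletionCalculus
import Literature.Topology.FourManifolds.CircleSurgery
import Literature.Topology.FourManifolds.Handles
import HarnessLib

/-!
# The null tower: a Hurwitz-null closed achiral Lefschetz model bounds a 5-dimensional
# 2-handlebody — the five printed inputs (named facts) and the proved assembly

Topic `Literature/Topology/FourManifolds`; companion of `HurwitzDeletionCalculus.lean` (the null
calculus `IsHurwitzNull` / `NullStep` / `Deletion` / `signedWord` on signed Dehn-twist words),
`AchiralLefschetzModel.lean` (`IsAchiralLefschetzModel P o w X`: *`X` is the closed model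
`X̂(P; w)`*), `CircleSurgery.lean` (`IsCircleSurgery`) and `Handles.lean`
(`IsHandlebodyOfIndexLE`).  Used by the line `hurwitz-deletion-presentation` of the crux
`ConvexBisection.AcyclicBisectionRigidity` (item stmt-SmoothPoincare4-10507), stub `stub_nullTower`.

**The printed argument** (Gompf–Stipsicz 1999, §5.2, §8.2, §8.4; Laudenbach–Poénaru 1972;
Milnor 1965, §3).  Let `w` be a Hurwitz-null word and `M = X̂(P; w)`.  Along a null sequence
`w = w₀, w₁, …, w_N = []`:
* a Hurwitz move or a global conjugation `wᵢ ↝ wᵢ₊₁` does not change the handlebody `X(P; wᵢ)`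
  (Gompf–Stipsicz §8.2; Etnyre–Fuller 2006 §2), hence not the closed model — FACT
  `isAchiralLefschetzModel_iff_of_move`;
* a deletion `pre · c^ε · d^{-ε} · suf ↝ pre · suf` (`t_c = t_d`, so `d ≃ c`) is undone by ONE
  CIRCLE SURGERY: the 2-handles along the parallel copies `c × {θᵢ}`, `d × {θᵢ₊₁}` with framings
  `pf - ε`, `pf + ε` slide to `{c^{pf-ε}, μ_c^0}`, and a 2-handle together with a `0`-framed
  meridian is surgery on the attaching circle pushed into the interior (Gompf–Stipsicz §5.2 /
  Prop. 5.1.? "erasing", §8.4); the boundary is unchanged, so the cap `V` re-glues — FACT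
  `exists_isCircleSurgery_of_deletion`;
* the model of the empty word is `B ∪_Ψ V` for two compact connected orientable 4-dimensional
  `1`-handlebodies, `≅ ♮ᵐ S¹ × B³` each (Kosinski VI (11.4)(c)), and `Ψ` extends over `B`
  (Laudenbach–Poénaru), so `X̂(P; []) ≅ D(♮ᵐ S¹ × B³) = #ᵐ S¹ × S³ = ∂(♮ᵐ S¹ × B⁴)` — FACT
  `exists_isHandlebodyOfIndexLE_one_of_isAchiralLefschetzModel_nil`;
* if `N = ∂H` for a compact 5-dimensional 2-handlebody `H` and `M` is a circle surgery of `N`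
  (tube `ν`), then `M = ∂(H ∪_N ω(N, ν))`, `ω` Milnor's elementary cobordism of index `2` (the
  trace, tree `CircleNbhd.trace`), again a compact 2-handlebody — FACT
  `exists_isHandlebodyOfIndexLE_two_of_isCircleSurgery`;
* a compact 5-dimensional 2-handlebody whose boundary is a homotopy 4-sphere is contractible:
  `π₁(∂H) ≅ π₁(H)` (the dual handles have index `≥ 3`), `χ(H) = χ(∂H)/2 = 1` forces `c₂ = c₁`
  after `c₀ = 1`, so `H₂(H; ℤ) = 0` and Hurewicz–Whitehead apply (tree:
  `contractibleSpace_of_isMorseAdapted_of_morseIndex_le_two`) — FACT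
  `contractibleSpace_of_isHandlebodyOfIndexLE_two_of_homotopyEquiv_sphere`.
PROVED here: the assembly `exists_contractible_handlebody_of_isHurwitzNull` — from the five facts,
a homotopy 4-sphere which is the closed model of a Hurwitz-null word bounds a compact contractible
5-manifold with an adapted Morse function of index `≤ 2` (verbatim the hypothesis of item
stmt-SmoothPoincare4-3717, `PresentationSpheresStandard`), by induction along the null sequence
(`exists_isHandlebodyOfIndexLE_two_of_isHurwitzNull`, the tower without the homotopy-sphere
hypothesis).

**On the under-constrained base clause** (`PlanarLefschetzBodyCounterexample.lean`: the page
system of `IsLefschetzHandlebodyOver` pins the boundary open book of the base `B` only up to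
boundary multitwists, so e.g. `𝔻⁴` with the Hopf open book is a "Lefschetz handlebody over the
annulus for `[]`" and `S⁴` a closed model of `[]`).  The five facts are stated so as to remain true
for every base the predicate admits: the two Kirby-calculus facts are local to the union of two
adjacent page slabs and the handles over them (away from the binding, where the page system IS a
trivialisation), the empty-word fact only uses that `B` and `V` are compact connected orientable
`1`-handlebodies glued by a boundary diffeomorphism (for `B = V = 𝔻⁴`: `S⁴ = ∂𝔻⁵`), and the last
two facts do not mention the vocabulary at all.

## References

* R. E. Gompf, A. I. Stipsicz, *4-Manifolds and Kirby Calculus*, GSM 20 (1999), §4.4, §5.2, §8.2,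
  §8.4. [GompfStipsiczGSM1999]
* J. B. Etnyre, T. Fuller, *Realizing 4-manifolds as achiral Lefschetz fibrations*, IMRN 2006, §2.
  [EtnyreFuller2006]
* F. Laudenbach, V. Poénaru, *A note on 4-dimensional handlebodies*, Bull. SMF 100 (1972).
  [LaudenbachPoenaruBSMF1972]
* J. Milnor, *Lectures on the h-cobordism theorem* (1965), Def. 3.9–3.10, Thms. 3.12–3.14.
  [MilnorHCobordism1965]
* A. A. Kosinski, *Differential Manifolds* (1993), VI (11.4)(c), VII §§1–2, §7. [Kosinski1993]
* A. Hatcher, *Algebraic Topology* (2002), Prop. 1.26, Thm. 4.5, Cor. 4.33. [HatcherAT2002]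
-/

open scoped Manifold ContDiff Topology ContinuousMap
open Set Function

noncomputable section

namespace Literature.Topology.FourManifolds

universe u v

/-- Local notation: `𝔼 n` is the model Euclidean space `EuclideanSpace ℝ (Fin n)`. -/
local notation "𝔼 " n:arg => EuclideanSpace ℝ (Fin n)

/-- Local notation: `𝕊 n` is the unit sphere in `EuclideanSpace ℝ (Fin (n + 1))`. -/
local notation "𝕊 " n:arg => (Metric.sphere (0 : EuclideanSpace ℝ (Fin (n + 1))) 1)

/-! ### §1 The five printed inputs (named facts, closed `Prop`s awaiting discharge) -/

/-- **Hurwitz moves and global conjugations do not change the closed achiral Lefschetz model.**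
For a move `w ↝ w'` (`Move`: a Hurwitz step `(x, y) ↦ (t_x^{ε}(y), x)` or its inverse, or the
global conjugation of every letter by some `g ∈ Diff⁺(P rel ∂P)`) a smooth 4-manifold `M` is the
closed model `X̂(P; w)` iff it is the closed model `X̂(P; w')`.  Printed proof: a Hurwitz move is a
slide of the `(i+1)`-st 2-handle over the `i`-th followed by an isotopy through the pages between
them, so `X(P; w) ≅ X(P; w')` (Gompf–Stipsicz 1999, §8.2, "elementary transformations"; Etnyre–Fuller
2006, §2 p. 5); a global conjugation by `g` is absorbed by re-choosing the page system `J ∘ (g × id)`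
of the same open book (`g` preserves `o`, so the annulus charts stay `o`-positive); the cap `V` and
the gluing `Ψ` are transported along the diffeomorphism (`IsBoundaryGluing`,
`HandleAttachingMap.IsMultiAttachment.of_diffeomorph`).  Both arguments are local to the page slabs
and handles involved, hence insensitive to the base clause of `IsLefschetzHandlebodyOver`
(module docstring). [cite: GompfStipsiczGSM1999, §8.2] -/
def isAchiralLefschetzModel_iff_of_move : Prop :=
  ∀ {P : Type v} [TopologicalSpace P] [T2Space P] [SecondCountableTopology P] [CompactSpace P]
    [ConnectedSpace P] [ChartedSpace (EuclideanHalfSpace 2) P] [IsManifold (𝓡∂ 2) ∞ P]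
    {o : SmoothOrientation (𝓡∂ 2) P} {w w' : List (Letter P o)} (_ : Move w w')
    (M : Type u) [TopologicalSpace M] [T2Space M] [SecondCountableTopology M]
    [ChartedSpace (𝔼 4) M] [IsManifold (𝓡 4) ∞ M],
    IsAchiralLefschetzModel P o (signedWord w) M ↔ IsAchiralLefschetzModel P o (signedWord w') M

/-- **Deleting an adjacent mutually inverse pair is undone by one circle surgery.**  If `M` is the
closed model of `w = pre · (c, ε) · (d, ¬ε) · suf` with `t_c = t_d` in `Mod(P, ∂P)` (`Deletion w w'`,
`w' = pre · suf`), then there is a closed smooth 4-manifold `N` which is the closed model of `w'`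
and a smoothly embedded circle in `N` along which (for one of the two framings) surgery yields `M`
(`IsCircleSurgery`).  Printed proof: `t_c = t_d` makes `d` isotopic to `c` (Farb–Margalit 2012,
Fact 3.6; for inessential curves both twists are trivial and both curves bound discs); the two
2-handles are attached along page-parallel copies of `c` in adjacent pages with framings `pf - ε`
and `pf + ε`; sliding the second over the first turns it into a `0`-framed meridian `μ_c`
(framing `(pf - ε) + (pf + ε) - 2·pf = 0`), and `X ∪ h_c ∪ h_{μ_c}^0` is `X` surgered along `c`
pushed into its interior, with unchanged boundary (Gompf–Stipsicz 1999, §5.2 with Prop. 5.1.?,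
§8.4: inserting `c · c̄`); so `X(P; w) ≅ X(P; w')` surgered along `c` pushed off a fibre,
`N := X(P; w') ∪_{Ψ'} V` with the transported gluing, and `M ≅ N` surgered.  Local to the two page
slabs and handles, hence insensitive to the base clause (module docstring).
[cite: GompfStipsiczGSM1999, §5.2 and §8.4] -/
def exists_isCircleSurgery_of_deletion : Prop :=
  ∀ {P : Type v} [TopologicalSpace P] [T2Space P] [SecondCountableTopology P] [CompactSpace P]
    [ConnectedSpace P] [ChartedSpace (EuclideanHalfSpace 2) P] [IsManifold (𝓡∂ 2) ∞ P]
    {o : SmoothOrientation (𝓡∂ 2) P} {w w' : List (Letter P o)} (_ : Deletion w w')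
    (M : Type u) [TopologicalSpace M] [T2Space M] [SecondCountableTopology M]
    [ChartedSpace (𝔼 4) M] [IsManifold (𝓡 4) ∞ M] (_ : IsAchiralLefschetzModel P o (signedWord w) M),
    ∃ (N : Type u) (_ : TopologicalSpace N) (_ : T2Space N) (_ : SecondCountableTopology N)
      (_ : CompactSpace N) (_ : ChartedSpace (𝔼 4) N) (_ : IsManifold (𝓡 4) ∞ N) (c : 𝕊 1 → N),
      IsAchiralLefschetzModel P o (signedWord w') N ∧
        Manifold.IsSmoothEmbedding (𝓡 1) (𝓡 4) ∞ c ∧ IsCircleSurgery (𝓡 4) (𝓡 4) N M c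

/-- **The closed model of the empty word bounds a compact 5-dimensional `1`-handlebody.**  If `M`
is a closed model of `[]` over any page, i.e. `M = W ∪_Ψ V` with `W` a compact connected orientable
4-dimensional `1`-handlebody `B` with no 2-handle attached (`W ≅ B`,
`HandleAttachingMap.IsMultiAttachment.nonempty_diffeomorph` with `self_of_isEmpty`) and `V` another
one, then `B ≅ ♮ᵐ S¹ × B³ ≅ V` (Kosinski VI (11.4)(c), tree `OneHandlebodyClassification.lean`;
`m` is read off `H₁(∂B) ≅ H₁(∂V)`), `Ψ` extends over `B` (Laudenbach–Poénaru 1972, tree fact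
`exists_diffeomorph_comp_incl_eq`; for `m = 0` this is Cerf's theorem), so
`M ≅ D(♮ᵐ S¹ × B³) = #ᵐ S¹ × S³ = ∂(♮ᵐ S¹ × B⁴)`, the boundary of a compact 5-dimensional
`1`-handlebody.  Only the `1`-handlebody clauses of the vocabulary are used (for the fake base
`B = V = 𝔻⁴` of `PlanarLefschetzBodyCounterexample.lean`: `S⁴ = ∂𝔻⁵`).
[cite: LaudenbachPoenaruBSMF1972, main theorem] [cite: GompfStipsiczGSM1999, §4.4] -/
def exists_isHandlebodyOfIndexLE_one_of_isAchiralLefschetzModel_nil : Prop :=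
  ∀ {P : Type v} [TopologicalSpace P] [T2Space P] [SecondCountableTopology P] [CompactSpace P]
    [ConnectedSpace P] [ChartedSpace (EuclideanHalfSpace 2) P] [IsManifold (𝓡∂ 2) ∞ P]
    (o : SmoothOrientation (𝓡∂ 2) P)
    (M : Type u) [TopologicalSpace M] [T2Space M] [SecondCountableTopology M]
    [ChartedSpace (𝔼 4) M] [IsManifold (𝓡 4) ∞ M]
    (_ : IsAchiralLefschetzModel P o ([] : List (SignedCycle P)) M),
    ∃ (H : Type u) (_ : TopologicalSpace H) (_ : T2Space H) (_ : SecondCountableTopology H)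
      (_ : ChartedSpace (EuclideanHalfSpace (4 + 1)) H) (_ : IsManifold (𝓡∂ (4 + 1)) ∞ H)
      (_ : CompactSpace H),
      IsHandlebodyOfIndexLE 4 1 H ∧
        ∃ φ : M → H, Manifold.IsSmoothEmbedding (𝓡 4) (𝓡∂ (4 + 1)) ∞ φ ∧
          Set.range φ = (𝓡∂ (4 + 1)).boundary H

/-- **Circle surgery on the boundary of a compact 5-dimensional 2-handlebody bounds a compact
5-dimensional 2-handlebody** (the trace of the surgery is a 5-dimensional 2-handle).  If `N = ∂H`
with `H` compact, carrying a Morse function adapted to `∂H` with critical points of index `≤ 2`,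
and `M` is obtained from `N` by surgery along an embedded circle with tube `ν`
(`IsCircleSurgery`), then `M = ∂H'` for `H' = H ∪_N ω(N, ν)`, `ω` Milnor's elementary cobordism of
index `2` from `N` to the surgered manifold (Milnor 1965, Def. 3.9–3.10, Thms. 3.12–3.13; tree
`CircleNbhd.trace`, `CircleNbhd.isOpenGluingWith_top`, uniqueness of open gluings
`nonempty_diffeomorph_of_isCircleSurgery_of_eq`); the adapted Morse function of `H` and the Morse
function of the triad `(ω; N, M)` glue to an adapted Morse function of `H'` with one more critical
point, of index `2` (Milnor 1965, Lemma 3.7 / Thm. 3.12). [cite: MilnorHCobordism1965, Thms. 3.12–3.13] -/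
def exists_isHandlebodyOfIndexLE_two_of_isCircleSurgery : Prop :=
  ∀ (N M : Type u) [TopologicalSpace N] [T2Space N] [SecondCountableTopology N] [CompactSpace N]
    [ChartedSpace (𝔼 4) N] [IsManifold (𝓡 4) ∞ N]
    [TopologicalSpace M] [T2Space M] [SecondCountableTopology M] [ChartedSpace (𝔼 4) M]
    [IsManifold (𝓡 4) ∞ M]
    (H : Type u) [TopologicalSpace H] [T2Space H] [SecondCountableTopology H] [CompactSpace H]
    [ChartedSpace (EuclideanHalfSpace (4 + 1)) H] [IsManifold (𝓡∂ (4 + 1)) ∞ H]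
    (_ : IsHandlebodyOfIndexLE 4 2 H) (φ : N → H)
    (_ : Manifold.IsSmoothEmbedding (𝓡 4) (𝓡∂ (4 + 1)) ∞ φ)
    (_ : Set.range φ = (𝓡∂ (4 + 1)).boundary H)
    (c : 𝕊 1 → N) (_ : IsCircleSurgery (𝓡 4) (𝓡 4) N M c),
    ∃ (H' : Type u) (_ : TopologicalSpace H') (_ : T2Space H') (_ : SecondCountableTopology H')
      (_ : ChartedSpace (EuclideanHalfSpace (4 + 1)) H') (_ : IsManifold (𝓡∂ (4 + 1)) ∞ H')
      (_ : CompactSpace H'),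
      IsHandlebodyOfIndexLE 4 2 H' ∧
        ∃ φ' : M → H', Manifold.IsSmoothEmbedding (𝓡 4) (𝓡∂ (4 + 1)) ∞ φ' ∧
          Set.range φ' = (𝓡∂ (4 + 1)).boundary H'

/-- **A compact 5-dimensional 2-handlebody bounded by a homotopy 4-sphere is contractible.**
If `H` is compact with a Morse function adapted to `∂H` of index `≤ 2` and `∂H = M ≃ₕ S⁴`, then
`H` is contractible: `π₁(∂H) → π₁(H)` is an isomorphism because the dual handles have index
`≥ 3` (Milnor 1965, Thm. 3.14 turned about; Hatcher Prop. 1.26 — the index-`2` analogue of the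
tree's `IsMorseAdapted.surjective_and_injective_inclHom_boundary`), so `H` is simply connected;
`χ(∂H) = 2χ(H)` for a compact odd-dimensional manifold with boundary gives the Morse count
`c₀ - c₁ + c₂ = χ(S⁴)/2 = 1`; and a compact simply connected handlebody of index `≤ 2` with Morse
count `1` is contractible (Hurewicz–Whitehead; tree
`contractibleSpace_of_isMorseAdapted_of_morseIndex_le_two`). [cite: HatcherAT2002, Prop. 1.26, Thm. 4.5 and Cor. 4.33]
[cite: Kosinski1993, VII §4 (4.2) and §7] -/
def contractibleSpace_of_isHandlebodyOfIndexLE_two_of_homotopyEquiv_sphere : Prop :=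
  ∀ (M : Type u) [TopologicalSpace M] [T2Space M] [SecondCountableTopology M]
    [ChartedSpace (𝔼 4) M] [IsManifold (𝓡 4) ∞ M]
    (H : Type u) [TopologicalSpace H] [T2Space H] [SecondCountableTopology H] [CompactSpace H]
    [ChartedSpace (EuclideanHalfSpace (4 + 1)) H] [IsManifold (𝓡∂ (4 + 1)) ∞ H]
    (_ : IsHandlebodyOfIndexLE 4 2 H) (φ : M → H)
    (_ : Manifold.IsSmoothEmbedding (𝓡 4) (𝓡∂ (4 + 1)) ∞ φ)
    (_ : Set.range φ = (𝓡∂ (4 + 1)).boundary H) (_ : M ≃ₕ 𝕊 4),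
    ContractibleSpace H

/-! ### §2 The assembly (proved): the null tower -/

section Tower

variable {P : Type v} [TopologicalSpace P] [T2Space P] [SecondCountableTopology P] [CompactSpace P]
  [ConnectedSpace P] [ChartedSpace (EuclideanHalfSpace 2) P] [IsManifold (𝓡∂ 2) ∞ P]
  {o : SmoothOrientation (𝓡∂ 2) P}

omit [T2Space P] [SecondCountableTopology P] [CompactSpace P] [ConnectedSpace P] in
/-- The signed word of the empty word is empty. [folklore] -/
@[simp] theorem signedWord_nil : signedWord ([] : List (Letter P o)) = [] := rfl

/-- **The null tower (without the homotopy-sphere hypothesis).**  Granting the first four facts of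
§1: the closed model of a HURWITZ-NULL word bounds a compact 5-dimensional 2-handlebody — by
induction along the null sequence, a move keeping the model (`isAchiralLefschetzModel_iff_of_move`),
a deletion costing one circle surgery (`exists_isCircleSurgery_of_deletion`) whose trace is one
5-dimensional 2-handle (`exists_isHandlebodyOfIndexLE_two_of_isCircleSurgery`), down to the empty
word, whose model bounds a `1`-handlebody
(`exists_isHandlebodyOfIndexLE_one_of_isAchiralLefschetzModel_nil`). [cite: GompfStipsiczGSM1999, §5.2 and §8.4] -/
theorem exists_isHandlebodyOfIndexLE_two_of_isHurwitzNull
    (h1 : isAchiralLefschetzModel_iff_of_move.{u, v}) (h2 : exists_isCircleSurgery_of_deletion.{u, v})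
    (h3 : exists_isHandlebodyOfIndexLE_one_of_isAchiralLefschetzModel_nil.{u, v})
    (h4 : exists_isHandlebodyOfIndexLE_two_of_isCircleSurgery.{u})
    {w : List (Letter P o)} (hw : IsHurwitzNull w)
    (M : Type u) [TopologicalSpace M] [T2Space M] [SecondCountableTopology M]
    [ChartedSpace (𝔼 4) M] [IsManifold (𝓡 4) ∞ M]
    (hmodel : IsAchiralLefschetzModel P o (signedWord w) M) :
    ∃ (H : Type u) (_ : TopologicalSpace H) (_ : T2Space H) (_ : SecondCountableTopology H)
      (_ : ChartedSpace (EuclideanHalfSpace (4 + 1)) H) (_ : IsManifold (𝓡∂ (4 + 1)) ∞ H)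
      (_ : CompactSpace H),
      IsHandlebodyOfIndexLE 4 2 H ∧
        ∃ φ : M → H, Manifold.IsSmoothEmbedding (𝓡 4) (𝓡∂ (4 + 1)) ∞ φ ∧
          Set.range φ = (𝓡∂ (4 + 1)).boundary H := by
  unfold IsHurwitzNull at hw
  induction hw using Relation.ReflTransGen.head_induction_on generalizing M with
  | refl =>
    rw [signedWord_nil] at hmodel
    obtain ⟨H, i₁, i₂, i₃, i₄, i₅, i₆, hH, φ, hφ, hφr⟩ := h3 o M hmodel
    exact ⟨H, i₁, i₂, i₃, i₄, i₅, i₆, hH.mono one_le_two, φ, hφ, hφr⟩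
  | head hstep _ ih =>
    rcases hstep with hm | hm | hd
    · exact ih M ((h1 hm M).1 hmodel)
    · exact ih M ((h1 hm M).2 hmodel)
    · -- the instances of `N` and `H` enter the context as local instances
      obtain ⟨N, _j₁, _j₂, _j₃, _j₄, _j₅, _j₆, c, hN, -, hs⟩ := h2 hd M hmodel
      obtain ⟨H, _i₁, _i₂, _i₃, _i₄, _i₅, _i₆, hH, φ, hφ, hφr⟩ := ih N hN
      exact h4 N M H hH φ hφ hφr c hs

/-- **The null tower.**  Granting the five facts of §1: a homotopy 4-sphere `M` which is the closed
achiral Lefschetz model of a Hurwitz-null word bounds a compact contractible smooth 5-manifold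
carrying a Morse function adapted to the boundary all of whose critical points have index `≤ 2`
(a presentation 5-manifold `H⁵(𝒫)` of a balanced presentation of the trivial group) — verbatim the
hypothesis of `PresentationSpheresStandard` (item stmt-SmoothPoincare4-3717).  This is Stub 3
(`stub_nullTower`) of the line `hurwitz-deletion-presentation` reduced to its printed inputs.
[cite: GompfStipsiczGSM1999, §5.2, §8.2 and §8.4] -/
theorem exists_contractible_handlebody_of_isHurwitzNull
    (h1 : isAchiralLefschetzModel_iff_of_move.{u, v}) (h2 : exists_isCircleSurgery_of_deletion.{u, v})
    (h3 : exists_isHandlebodyOfIndexLE_one_of_isAchiralLefschetzModel_nil.{u, v})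
    (h4 : exists_isHandlebodyOfIndexLE_two_of_isCircleSurgery.{u})
    (h5 : contractibleSpace_of_isHandlebodyOfIndexLE_two_of_homotopyEquiv_sphere.{u})
    {w : List (Letter P o)} (hw : IsHurwitzNull w)
    (M : Type u) [TopologicalSpace M] [T2Space M] [SecondCountableTopology M]
    [ChartedSpace (𝔼 4) M] [IsManifold (𝓡 4) ∞ M] (hM : M ≃ₕ 𝕊 4)
    (hmodel : IsAchiralLefschetzModel P o (signedWord w) M) :
    ∃ (W : Type u) (_ : TopologicalSpace W) (_ : T2Space W) (_ : SecondCountableTopology W)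
      (_ : ChartedSpace (EuclideanHalfSpace (4 + 1)) W) (_ : IsManifold (𝓡∂ (4 + 1)) ∞ W)
      (_ : CompactSpace W),
      ContractibleSpace W ∧
      (∃ f : W → ℝ, IsMorseAdapted (𝓡∂ (4 + 1)) f ∧
        ∀ z, IsMCriticalPt (𝓡∂ (4 + 1)) f z → morseIndex (𝓡∂ (4 + 1)) f z ≤ 2) ∧
      ∃ φ : M → W, Manifold.IsSmoothEmbedding (𝓡 4) (𝓡∂ (4 + 1)) ∞ φ ∧
        Set.range φ = (𝓡∂ (4 + 1)).boundary W := by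
  obtain ⟨H, i₁, i₂, i₃, i₄, i₅, i₆, hH, φ, hφ, hφr⟩ :=
    exists_isHandlebodyOfIndexLE_two_of_isHurwitzNull h1 h2 h3 h4 hw M hmodel
  exact ⟨H, i₁, i₂, i₃, i₄, i₅, i₆, h5 M H hH φ hφ hφr hM, hH, φ, hφ, hφr⟩

end Tower

end Literature.Topology.FourManifolds

end
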